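import Summits.QuantumFields.YangMills.Theorems.BalabanLadderNTSkewResponseCoupling
import HarnessLib

/-!
# Route `ForcedResponseSkewness`, item `Assembly` (stmt-QuantumFields-23618), route rev 3: the transport lemma with RELATIVE
# localisation (core of the re-landed `assembly_proof`)

Route-file-independent helper (`--supports stmt-QuantumFields-23618`; imported by `Theorems/ForcedResponseSkewnessAssembly.lean`,
which keeps its rev-0 declarations append-only).  After the rev-3 repair of the cruxes (compact, shrinking, L¹-normalised supports;
localisation with tolerance `η(1 + |∂_cQ2|)`), the transport step reads: for ONE test function `v` of the residual's family,
chosen after the window `(Λ, T₀)`, with floor `ε`, ceiling `C/log²Λ ≤ ε/4` on `[Λ, 2Λ]`, relative localisation by a source `f`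
on `[1, 2Λ]` with `η ≤ 1/2`, `η ≤ ε/(8T₀)`, and scaling limits `Φ₂`, `Φ₃`, some `λ* > 0` has `LowerBounds G r (λ*·a)`:
MVT (`exists_level_and_slope_mul_le`) ⇒ `q'(c*) ≤ −ε/(2T₀)`, relative localisation ⇒ `Q3 ≤ (1−η)q' + η ≤ −ε/(8T₀)`, transport ⇒
`Q2 ≥ ε/4`, `|Q3| ≥ ε/(16T₀)` at spacing `λ*·a(β)` (`lowerBounds_of_floor_ceiling_localisation_rel`).

Honest label: bookkeeping of a conditional rung line (leaf R2a `BalabanLadder.NT`); the YM mass gap is NOT proved by this.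
-/

set_option autoImplicit false

noncomputable section

open scoped SchwartzMap
open MeasureTheory Filter Topology
open Literature.MathematicalPhysics.QuantumFieldTheory Literature.MathematicalPhysics.QuantumLattice
open Summit.QuantumFields.YangMills.Cruxes.OSLegsFromFemtoAndGap.DlrCollarTransfer

namespace Summit.QuantumFields.YangMills.Theorems.ForcedResponseSkewness

/-! ## §1 A drop forces a slope -/

/-- **A drop forces a slope (product form).**  If `q` is differentiable, `q c₀ ≥ ε` and `q (c₀ + T) ≤ ε/4` with `T > 0`,
`ε > 0`, then some `c ∈ (c₀, c₀+T)` has `q c > ε/2` and `2T · deriv q c ≤ −ε` (first crossing time of the level `ε/2` +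
the mean-value theorem; sibling of `exists_level_and_negative_slope` in `…ForcedResponseSkewnessAssembly`). [folklore] -/
theorem exists_level_and_slope_mul_le (q : ℝ → ℝ) (hq : Differentiable ℝ q) {c₀ T ε : ℝ}
    (hT : 0 < T) (hε : 0 < ε) (h0 : ε ≤ q c₀) (h1 : q (c₀ + T) ≤ ε / 4) :
    ∃ c ∈ Set.Ioo c₀ (c₀ + T), ε / 2 < q c ∧ 2 * T * deriv q c ≤ -ε := by
  have hqc : Continuous q := hq.continuous
  set S : Set ℝ := {c | c ∈ Set.Icc c₀ (c₀ + T) ∧ q c ≤ ε / 2} with hS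
  have hne : S.Nonempty := ⟨c₀ + T, ⟨⟨by linarith, le_rfl⟩, by linarith⟩⟩
  have hbdd : BddBelow S := ⟨c₀, fun c hc => hc.1.1⟩
  have hclosed : IsClosed S := by
    have : S = Set.Icc c₀ (c₀ + T) ∩ q ⁻¹' Set.Iic (ε / 2) := by
      ext c; simp [hS, Set.mem_Iic]
    rw [this]
    exact isClosed_Icc.inter (isClosed_Iic.preimage hqc)
  set t₂ := sInf S with ht₂
  have ht₂S : t₂ ∈ S := hclosed.csInf_mem hne hbdd
  have ht₂le : t₂ ≤ c₀ + T := ht₂S.1.2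
  have hqt₂ : q t₂ ≤ ε / 2 := ht₂S.2
  have habove : ∀ c, c₀ ≤ c → c < t₂ → ε / 2 < q c := by
    intro c hc hct
    by_contra hcon
    have hcS : c ∈ S := ⟨⟨hc, by linarith⟩, not_lt.1 hcon⟩
    have : t₂ ≤ c := csInf_le hbdd hcS
    linarith
  have ht₂gt : c₀ < t₂ := by
    rcases lt_or_ge c₀ t₂ with h | h
    · exact h
    · exfalso
      have : t₂ = c₀ := le_antisymm h ht₂S.1.1
      rw [this] at hqt₂
      linarith
  obtain ⟨c, hc, hderiv⟩ := exists_deriv_eq_slope q ht₂gt hqc.continuousOn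
    (hq.differentiableOn.mono Set.Ioo_subset_Icc_self)
  refine ⟨c, ⟨hc.1, lt_of_lt_of_le hc.2 ht₂le⟩, habove c hc.1.le hc.2, ?_⟩
  rw [hderiv]
  have hpos : 0 < t₂ - c₀ := by linarith
  have hnum : q t₂ - q c₀ ≤ -(ε / 2) := by linarith
  have hTle : t₂ - c₀ ≤ T := by linarith
  have hslope : (q t₂ - q c₀) / (t₂ - c₀) ≤ -(ε / 2) / T := by
    rw [div_le_div_iff₀ hpos hT]
    nlinarith
  calc 2 * T * ((q t₂ - q c₀) / (t₂ - c₀)) ≤ 2 * T * (-(ε / 2) / T) :=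
        mul_le_mul_of_nonneg_left hslope (by positivity)
    _ = -ε := by field_simp

/-! ## §2 The transport with relative localisation -/

section Lattice

variable (G : Type) [Group G] [TopologicalSpace G] [IsTopologicalGroup G] [CompactSpace G]
  [MeasurableSpace G] [BorelSpace G] (r : LatticeRep G) (a : ℝ → ℝ)

/-- **`LowerBounds` in a rescaled unit from floor, ceiling, RELATIVE localisation and scaling limits** (route
rev 3: all data for ONE test function `v` of the residual's support-shrinking family, chosen after the window).
For a compact `G` (Borel σ-algebra), `r`, an antitone unit map `a > 0` with ratio law `a(c)/a(c+t) → e^{κt}`, a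
window `Λ ≥ 2` and coupling range `T₀ ≥ 1` with `e^{κT₀} = 3Λ/2` and `C/log²Λ ≤ ε/4`, a positive-time `v` with
`θv, v` disjointly supported carrying the clause-(i) floor `ε`, the ceiling `Q2 ≤ C/log²Λ` on `l ∈ [Λ, 2Λ]`, the
relative localisation `|∂_cQ2 − Q3(f,θv,v)| ≤ η(1 + |∂_cQ2|)` on `l ∈ [1, 2Λ]` with `η ≤ 1/2`, `η ≤ ε/(8T₀)`, and
the scaling limits `Φ₂`, `Φ₃` of `Q2(θv,v)`, `Q3(f,θv,v)`: some `λ* > 0` has `LowerBounds G r (λ*·a)` (clause (i)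
with `ε/4`, clause (ii) with the triple `(f, θv, v)` and `ε/(16T₀)`).  (Supersedes, for rev 3, the rev-0
`lowerBounds_of_floor_ceiling_localisation` of `…ForcedResponseSkewnessAssembly`, kept there append-only.) [folklore] -/
theorem lowerBounds_of_floor_ceiling_localisation_rel
    (v f : 𝓢(EuclideanSpace ℝ (Fin 4), ℝ)) (κ ε β₅ Λ₅ C : ℝ) (Φ₂ Φ₃ : ℝ → ℝ) (Λ T₀ η : ℝ)
    (hapos : ∀ β, 0 < a β) (hanti : Antitone a)
    (hratio : ∀ t : ℝ, 0 ≤ t →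
      Filter.Tendsto (fun c : ℝ => a c / a (c + t)) Filter.atTop (nhds (Real.exp (κ * t))))
    (hsupp : tsupport v ⊆ {y : EuclideanSpace ℝ (Fin 4) | 0 < y 0})
    (hdisj : Disjoint (tsupport (thetaTest 4 v)) (tsupport v))
    (hε : 0 < ε) (hΛ2 : 2 ≤ Λ) (hT₀1 : 1 ≤ T₀) (hexp : Real.exp (κ * T₀) = 3 * Λ / 2)
    (hceil : C / Real.log Λ ^ 2 ≤ ε / 4) (hη1 : η ≤ 1 / 2) (hη2 : η ≤ ε / (8 * T₀))
    (hfloor : ∀ β : ℝ, β₅ ≤ β → ∀ L : ℕ, Λ₅ ≤ a β * L → ε ≤ Q2 G r β L (a β) (thetaTest 4 v) v)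
    (hQ2lim : ∀ η' : ℝ, 0 < η' → ∀ Λ' : ℝ, 1 ≤ Λ' → ∃ β₆ Λ₆ : ℝ, ∀ β : ℝ, β₆ ≤ β → ∀ L : ℕ,
      Λ₆ ≤ a β * L → ∀ l : ℝ, l ∈ Set.Icc 1 Λ' → |Q2 G r β L (l * a β) (thetaTest 4 v) v - Φ₂ l| ≤ η')
    (hC : ∃ β₆ Λ₆ : ℝ, ∀ β : ℝ, β₆ ≤ β → ∀ L : ℕ, Λ₆ ≤ a β * L →
      ∀ l : ℝ, l ∈ Set.Icc Λ (2 * Λ) → Q2 G r β L (l * a β) (thetaTest 4 v) v ≤ C / Real.log Λ ^ 2)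
    (hfv : Disjoint (tsupport f) (tsupport v)) (hfθ : Disjoint (tsupport f) (tsupport (thetaTest 4 v)))
    (hloc : ∃ β₆ Λ₆ : ℝ, ∀ β : ℝ, β₆ ≤ β → ∀ L : ℕ, Λ₆ ≤ a β * L → ∀ l : ℝ, l ∈ Set.Icc 1 (2 * Λ) →
      |deriv (fun c : ℝ => Q2 G r c L (l * a β) (thetaTest 4 v) v) β - Q3 G r β L (l * a β) f (thetaTest 4 v) v| ≤
        η * (1 + |deriv (fun c : ℝ => Q2 G r c L (l * a β) (thetaTest 4 v) v) β|))
    (hQ3lim : ∀ η' : ℝ, 0 < η' → ∀ Λ' : ℝ, 1 ≤ Λ' → ∃ β₆ Λ₆ : ℝ, ∀ β : ℝ, β₆ ≤ β → ∀ L : ℕ,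
      Λ₆ ≤ a β * L → ∀ l : ℝ, l ∈ Set.Icc 1 Λ' → |Q3 G r β L (l * a β) f (thetaTest 4 v) v - Φ₃ l| ≤ η') :
    ∃ lam : ℝ, 0 < lam ∧ LowerBounds G r (fun β => lam * a β) := by
  have hT₀ : 0 < T₀ := by linarith
  have hΛpos : 0 < Λ := by linarith
  have h2Λ1 : (1 : ℝ) ≤ 2 * Λ := by linarith
  have hηpos' : 0 ≤ η := by
    have : 0 < ε / (8 * T₀) := by positivity
    -- `η` may be any number `≤ min`; only `η ≤ 1/2`, `η ≤ ε/(8T₀)` are used below, and `0 ≤ η` via the bound itself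
    by_contra h
    rw [not_le] at h
    obtain ⟨β₃, Λ₃, hloc'⟩ := hloc
    -- at any admissible point the left side is `≥ 0` and the right side `< 0` unless `1 + |·| = 0`: contradiction
    obtain ⟨L, hL⟩ := exists_nat_ge (Λ₃ / a β₃)
    have hL' : Λ₃ ≤ a β₃ * L := by
      have := (div_le_iff₀ (hapos β₃)).1 hL; linarith [mul_comm (a β₃) (L : ℝ)]
    have hb := hloc' β₃ le_rfl L hL' 1 ⟨le_rfl, h2Λ1⟩
    have hneg : η * (1 + |deriv (fun c : ℝ => Q2 G r c L (1 * a β₃) (thetaTest 4 v) v) β₃|) < 0 :=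
      mul_neg_of_neg_of_pos h (by positivity)
    linarith [abs_nonneg (deriv (fun c : ℝ => Q2 G r c L (1 * a β₃) (thetaTest 4 v) v) β₃ -
      Q3 G r β₃ L (1 * a β₃) f (thetaTest 4 v) v)]
  -- Step 1: the thresholds
  obtain ⟨β₂, Λ₂, hceil'⟩ := hC
  obtain ⟨β₃, Λ₃, hloc'⟩ := hloc
  have hη' : 0 < ε / (32 * T₀) := by positivity
  obtain ⟨β₄, Λ₄, hQ2'⟩ := hQ2lim (ε / (32 * T₀)) hη' (2 * Λ) h2Λ1
  obtain ⟨β₆, Λ₆, hQ3'⟩ := hQ3lim (ε / (32 * T₀)) hη' (2 * Λ) h2Λ1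
  -- the ratio law at `t = T₀`: eventually `a c / a (c + T₀) ∈ [Λ, 2Λ]`
  have hrat : ∀ᶠ c in atTop, a c / a (c + T₀) ∈ Set.Icc Λ (2 * Λ) := by
    have ht := hratio T₀ hT₀.le
    rw [hexp] at ht
    exact ht.eventually (Icc_mem_nhds (by linarith) (by linarith))
  obtain ⟨c₁, hc₁⟩ := Filter.eventually_atTop.1 hrat
  -- Step 2: one large coupling `c₀` and ONE large torus `L₀`
  set c₀ : ℝ := max (max (max β₅ β₂) (max β₃ β₄)) (max β₆ c₁) with hc₀def
  have hc₀β₅ : β₅ ≤ c₀ := le_trans (le_trans (le_max_left _ _) (le_max_left _ _)) (le_max_left _ _)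
  have hc₀β₂ : β₂ ≤ c₀ := le_trans (le_trans (le_max_right _ _) (le_max_left _ _)) (le_max_left _ _)
  have hc₀β₃ : β₃ ≤ c₀ := le_trans (le_trans (le_max_left _ _) (le_max_right _ _)) (le_max_left _ _)
  have hc₀β₄ : β₄ ≤ c₀ := le_trans (le_trans (le_max_right _ _) (le_max_right _ _)) (le_max_left _ _)
  have hc₀β₆ : β₆ ≤ c₀ := le_trans (le_max_left _ _) (le_max_right _ _)
  have hc₀c₁ : c₁ ≤ c₀ := le_trans (le_max_right _ _) (le_max_right _ _)
  have haT : 0 < a (c₀ + T₀) := hapos _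
  set Λs : ℝ := max (max (max Λ₅ Λ₂) (max Λ₃ Λ₄)) (max Λ₆ 0) with hΛsdef
  have hΛsΛ₅ : Λ₅ ≤ Λs := le_trans (le_trans (le_max_left _ _) (le_max_left _ _)) (le_max_left _ _)
  have hΛsΛ₂ : Λ₂ ≤ Λs := le_trans (le_trans (le_max_right _ _) (le_max_left _ _)) (le_max_left _ _)
  have hΛsΛ₃ : Λ₃ ≤ Λs := le_trans (le_trans (le_max_left _ _) (le_max_right _ _)) (le_max_left _ _)
  have hΛsΛ₄ : Λ₄ ≤ Λs := le_trans (le_trans (le_max_right _ _) (le_max_right _ _)) (le_max_left _ _)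
  have hΛsΛ₆ : Λ₆ ≤ Λs := le_trans (le_max_left _ _) (le_max_right _ _)
  obtain ⟨L₀, hL₀⟩ := exists_nat_ge (Λs / a (c₀ + T₀))
  have hL₀' : Λs ≤ a (c₀ + T₀) * L₀ := by
    have h := (div_le_iff₀ haT).1 hL₀
    linarith [mul_comm (a (c₀ + T₀)) (L₀ : ℝ)]
  have hmono : ∀ c : ℝ, c ≤ c₀ + T₀ → a (c₀ + T₀) * L₀ ≤ a c * L₀ := fun c hc =>
    mul_le_mul_of_nonneg_right (hanti hc) (Nat.cast_nonneg L₀)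
  -- Step 3: `q(c) := Q2_{c,L₀,a(c₀)}(θv,v)`: floor at `c₀`, ceiling at `c₀ + T₀`, MVT
  have hqdiff : Differentiable ℝ (fun c : ℝ => Q2 G r c L₀ (a c₀) (thetaTest 4 v) v) :=
    Summit.QuantumFields.YangMills.Cruxes.NT.SkewResponse.differentiable_Q2_coupling G r L₀ (a c₀)
      (thetaTest 4 v) v
  have hq0 : ε ≤ Q2 G r c₀ L₀ (a c₀) (thetaTest 4 v) v :=
    hfloor c₀ hc₀β₅ L₀ (le_trans hΛsΛ₅ (le_trans hL₀' (hmono c₀ (by linarith))))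
  have hq1 : Q2 G r (c₀ + T₀) L₀ (a c₀) (thetaTest 4 v) v ≤ ε / 4 := by
    have hl : a c₀ / a (c₀ + T₀) ∈ Set.Icc Λ (2 * Λ) := hc₁ c₀ hc₀c₁
    have h := hceil' (c₀ + T₀) (by linarith) L₀ (le_trans hΛsΛ₂ hL₀') (a c₀ / a (c₀ + T₀)) hl
    rw [div_mul_cancel₀ _ haT.ne'] at h
    exact h.trans hceil
  obtain ⟨cs, hcs, hqcs, hdq'⟩ :=
    exists_level_and_slope_mul_le (fun c : ℝ => Q2 G r c L₀ (a c₀) (thetaTest 4 v) v) hqdiff hT₀ hε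
      hq0 hq1
  have hdq : deriv (fun c : ℝ => Q2 G r c L₀ (a c₀) (thetaTest 4 v) v) cs ≤ -(ε / (2 * T₀)) := by
    have h2T : (0 : ℝ) < 2 * T₀ := by positivity
    have h1 : deriv (fun c : ℝ => Q2 G r c L₀ (a c₀) (thetaTest 4 v) v) cs ≤ -ε / (2 * T₀) := by
      rw [le_div_iff₀ h2T]; linarith
    rwa [neg_div] at h1
  have hqcs' : ε / 2 < Q2 G r cs L₀ (a c₀) (thetaTest 4 v) v := hqcs
  -- Step 4: `λ* := a(c₀)/a(c*) ∈ [1, 2Λ]`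
  have hacs : 0 < a cs := hapos cs
  have ha_cs_le : a cs ≤ a c₀ := hanti hcs.1.le
  have ha_cs_ge : a (c₀ + T₀) ≤ a cs := hanti hcs.2.le
  obtain ⟨lam, hlamdef⟩ : ∃ lam : ℝ, lam = a c₀ / a cs := ⟨_, rfl⟩
  have hlam1 : 1 ≤ lam := by
    rw [hlamdef, le_div_iff₀ hacs, one_mul]
    exact ha_cs_le
  have hlam2 : lam ≤ 2 * Λ := by
    calc lam = a c₀ / a cs := hlamdef
      _ ≤ a c₀ / a (c₀ + T₀) := div_le_div_of_nonneg_left (hapos c₀).le haT ha_cs_ge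
      _ ≤ 2 * Λ := (hc₁ c₀ hc₀c₁).2
  have hlampos : 0 < lam := by linarith
  have hlam_mem : lam ∈ Set.Icc 1 (2 * Λ) := ⟨hlam1, hlam2⟩
  have hlam_mul : lam * a cs = a c₀ := by rw [hlamdef]; exact div_mul_cancel₀ _ hacs.ne'
  have hLcs : a (c₀ + T₀) * L₀ ≤ a cs * L₀ := hmono cs hcs.2.le
  -- Step 5: relative localisation at `(c*, L₀, λ*)`: `Q3_{c*,L₀,a(c₀)}(f,θv,v) ≤ −ε/(8T₀)`
  have hl3 := hloc' cs (by linarith [hcs.1]) L₀ (le_trans hΛsΛ₃ (le_trans hL₀' hLcs)) lam hlam_mem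
  rw [hlam_mul] at hl3
  have hQ3cs : Q3 G r cs L₀ (a c₀) f (thetaTest 4 v) v ≤ -(ε / (8 * T₀)) := by
    set D := deriv (fun c : ℝ => Q2 G r c L₀ (a c₀) (thetaTest 4 v) v) cs with hD
    have hDle : D ≤ -(ε / (2 * T₀)) := hdq
    have hDneg : D < 0 := by
      have : 0 < ε / (2 * T₀) := by positivity
      linarith
    have habsD : |D| = -D := abs_of_neg hDneg
    have h := (abs_le.1 hl3).1
    rw [habsD] at h
    -- `Q3 ≤ D + η(1 − D) = D + η + η(−D) ≤ D + η + (−D)/2 = D/2 + η`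
    have hηD : η * (-D) ≤ (1 / 2) * (-D) := mul_le_mul_of_nonneg_right hη1 (by linarith)
    have e : -(ε / (2 * T₀)) / 2 + ε / (8 * T₀) = -(ε / (8 * T₀)) := by field_simp; ring
    nlinarith [hDle, hη2, hηD, e]
  -- Step 6: the two limit clauses at `(c*, L₀, λ*)`
  have h2cs := hQ2' cs (by linarith [hcs.1]) L₀ (le_trans hΛsΛ₄ (le_trans hL₀' hLcs)) lam hlam_mem
  rw [hlam_mul] at h2cs
  have hΦ₂ : ε / 2 - ε / (32 * T₀) < Φ₂ lam := by
    have h := (abs_le.1 h2cs).2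
    linarith
  have h3cs := hQ3' cs (by linarith [hcs.1]) L₀ (le_trans hΛsΛ₆ (le_trans hL₀' hLcs)) lam hlam_mem
  rw [hlam_mul] at h3cs
  have hΦ₃ : Φ₃ lam ≤ -(ε / (8 * T₀)) + ε / (32 * T₀) := by
    have h := (abs_le.1 h3cs).1
    linarith
  have hT32 : ε / (32 * T₀) ≤ ε / 32 :=
    div_le_div_of_nonneg_left hε.le (by norm_num) (by linarith)
  -- Step 7: transport to every large `β` and torus, in the unit `λ*·a`
  have hthr : ∀ (Λ' : ℝ) (β : ℝ) (L : ℕ), Λ' ≤ max Λ₄ Λ₆ →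
      lam * max Λ₄ Λ₆ ≤ (fun β => lam * a β) β * L → Λ' ≤ a β * L := by
    intro Λ' β L hΛ' hL
    have h : lam * max Λ₄ Λ₆ ≤ lam * (a β * L) := by simpa [mul_assoc] using hL
    exact le_trans hΛ' (le_of_mul_le_mul_left h hlampos)
  refine ⟨lam, hlampos, ?_, ?_⟩
  · -- clause (i): `Q2 ≥ ε/4` at spacing `λ*·a(β)`
    refine ⟨v, ε / 4, max β₄ β₆, lam * max Λ₄ Λ₆, hsupp, by positivity, ?_⟩
    intro β hβ L hL
    have hb := hQ2' β (le_trans (le_max_left _ _) hβ) L (hthr Λ₄ β L (le_max_left _ _) hL) lam hlam_mem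
    have h := (abs_le.1 hb).1
    show ε / 4 ≤ Q2 G r β L (lam * a β) (thetaTest 4 v) v
    linarith
  · -- clause (ii): `Q3(f, θv, v) ≤ −ε/(16T₀)` at spacing `λ*·a(β)`
    refine ⟨f, thetaTest 4 v, v, ε / (16 * T₀), max β₄ β₆, lam * max Λ₄ Λ₆, hfθ, hdisj, hfv,
      by positivity, ?_⟩
    intro β hβ L hL
    have hb := hQ3' β (le_trans (le_max_right _ _) hβ) L (hthr Λ₆ β L (le_max_right _ _) hL) lam
      hlam_mem
    have h := (abs_le.1 hb).2
    have e : -(ε / (8 * T₀)) + ε / (32 * T₀) + ε / (32 * T₀) = -(ε / (16 * T₀)) := by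
      field_simp; ring
    have hQ3le : Q3 G r β L (lam * a β) f (thetaTest 4 v) v ≤ -(ε / (16 * T₀)) := by linarith
    have hpos : 0 < ε / (16 * T₀) := by positivity
    show ε / (16 * T₀) ≤ |Q3 G r β L (lam * a β) f (thetaTest 4 v) v|
    rw [abs_of_nonpos (by linarith)]
    linarith

end Lattice

end Summit.QuantumFields.YangMills.Theorems.ForcedResponseSkewness

end
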